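import Summits.HubbardSuperconductivity.HubbardLadder.Bounds.StiffnessCeilings
import Summits.HubbardSuperconductivity.HubbardSuperconductivity.Theorems.NoGoNogoThesis
import Literature.MathematicalPhysics.QuantumLattice.FockMapOpD4
import Literature.MathematicalPhysics.QuantumLattice.MagneticHubbardTorusTrivialField
import HarnessLib

/-!
# Hubbard ladder — Bounds: proofs of the rotation-averaged kinetic ceiling and the explicit
# momentum-sum stiffness bound

HONEST FRAMING (cell pub-hubbard): ladder R1–R4 with certified numbers; no claim on H/H₀. These
are bounds for MODEL CLASSES (finite-range lattice fermions with gauge-invariant interactions);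
no materials claim. Companion text: `pub-hubbard/paper/bounds.tex` §2 (Cor. 2.2(iii), Remark 2.1),
status table `pub-hubbard/pub-hubbard-bounds/BOUNDS.md`.

This file CLOSES two of the three `@[conjecture]` nodes of
`Summits/HubbardSuperconductivity/HubbardLadder/Bounds/StiffnessCeilings.lean` (the third,
`KinWeightXCeiling`, is closed in the companion file `Bounds/KinWeightXCeilingProof.lean`):

* `groundStateKinWeightCeiling_holds : GroundStateKinWeightCeiling` — for `L ≥ 3`, all `U`,
  `δ ≥ -1`, the `(N_L, S^z = 0)` sector of `hubbardTorus 2 L 1 U` contains a unit ground state `ψ`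
  with
  `K(ψ) ≤ ν N_L/2 + Σ_k (cos(2πk₁/L) + cos(2πk₂/L) - ν)⁺` for every `ν`.
* `halfBathtubStiffnessBound_holds : HalfBathtubStiffnessBound` — the explicit momentum-sum ceiling
  on every flux stiffness (`halfBathtubStiffnessBound_of_ceiling` of the tree, now unconditional):
  Hazra–Verma–Randeria, PRX 9 (2019) 031049, eq. (3) at `T = 0`, as a kernel-checked theorem for the
  square-lattice Hubbard torus.
Proof of the rotation-averaged ceiling (a two-state minimum argument; no ground-state degeneracy
bookkeeping is needed):
1. `Σ_σ Re⟨φ, T_σ φ⟩ = 2 (K_x(φ) + K_y(φ))` on the `L × L` torus, `L ≥ 3` (each bond is one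
   positively oriented edge met in both orders; `sum_sum_ite_torusGraph_two_adj`).
2. The tree's dual bathtub inequality `re_hopOp_le_oneBodyDual` (Lieb–Loss bathtub, Legendre form)
   at level `2ν`, summed over the two spins, with `Σ_σ Re⟨φ, N_σ φ⟩ = N` on the `N`-particle sector:
   `K_x(φ) + K_y(φ) ≤ ν N + 2 Σ_k (cos k₁ + cos k₂ - ν)⁺` for every unit `N`-particle `φ`.
3. The second-quantised rotation `Γ = Γ(r)` (`fockMapOp (d4Orb (r 1))`, tree file `FockMapOpD4`)
   maps sector ground states to sector ground states, is unitary, and `K_y(Γψ) = K_x(ψ)`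
   (`Γ c†_{x} c_{y} = c†_{rx} c_{ry} Γ` and `r(x + e₁) = r x + e₂`).
4. Hence `K_x(Γψ) + K_x(ψ) ≤ ν N + 2 S(ν)`; whichever of `ψ`, `Γψ` has the smaller `K_x` witnesses
   the claim.

References (keys of `lean/references.bib`): HazraVermaRanderia2019 eqs. (2)–(4);
ParamekantiTrivediRanderia1998; LiebLoss2001 (bathtub principle, Thm 1.14); Scalapino1995 §2.
-/

noncomputable section

namespace Summit.HubbardSuperconductivity.HubbardLadder.Bounds

open Matrix Finset Real
open Literature.MathematicalPhysics.QuantumLattice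
open Literature.MathematicalPhysics.QuantumFieldTheory
open Literature.Probability.LatticeModels
open Literature.MathematicalPhysics.QuantumLattice.LangerMattis
open Literature.MathematicalPhysics.QuantumLattice.RayleighBound
open scoped ComplexOrder ComplexConjugate

/-! ### Step 0: conjugating a hopping monomial by `Γ(f)` -/

/-- For a bijection `f` of the orbitals, `⟨Γ(f)ψ, c†_{f a} c_{f b} Γ(f)ψ⟩ = ⟨ψ, c†_a c_b ψ⟩`
(`Γ(f)` is unitary and intertwines `c†_a ↦ c†_{f a}`, `c_b ↦ c_{f b}`). -/
theorem star_fockMapOp_mulVec_dotProduct_hop {ι : Type*} [LinearOrder ι] [Fintype ι]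
    (f : ι → ι) (hf : Function.Bijective f) (a b : ι) (ψ : Fock ι) :
    star (fockMapOp f *ᵥ ψ) ⬝ᵥ ((creation (f a) * annihilation (f b)) *ᵥ (fockMapOp f *ᵥ ψ)) =
      star ψ ⬝ᵥ ((creation a * annihilation b) *ᵥ ψ) := by
  have hcomm : creation (f a) * annihilation (f b) * fockMapOp f =
      fockMapOp f * (creation a * annihilation b) := by
    rw [Matrix.mul_assoc, ← fockMapOp_mul_annihilation f hf b, ← Matrix.mul_assoc,
      ← fockMapOp_mul_creation f a, Matrix.mul_assoc]
  calc star (fockMapOp f *ᵥ ψ) ⬝ᵥ ((creation (f a) * annihilation (f b)) *ᵥ (fockMapOp f *ᵥ ψ))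
      = star (fockMapOp f *ᵥ ψ) ⬝ᵥ (fockMapOp f *ᵥ ((creation a * annihilation b) *ᵥ ψ)) := by
        rw [mulVec_mulVec, mulVec_mulVec, hcomm]
    _ = star ψ ⬝ᵥ ((creation a * annihilation b) *ᵥ ψ) := by
        rw [star_mulVec, ← dotProduct_mulVec, mulVec_mulVec,
          conjTranspose_fockMapOp_mul_self f hf.injective, one_mulVec]

/-- `Γ(f)` preserves the norm: `⟨Γ(f)ψ, Γ(f)ψ⟩ = ⟨ψ, ψ⟩` for injective `f`. -/
theorem star_fockMapOp_mulVec_dotProduct_self {ι : Type*} [LinearOrder ι] [Fintype ι]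
    (f : ι → ι) (hf : Function.Injective f) (ψ : Fock ι) :
    star (fockMapOp f *ᵥ ψ) ⬝ᵥ (fockMapOp f *ᵥ ψ) = star ψ ⬝ᵥ ψ := by
  rw [star_mulVec, ← dotProduct_mulVec, mulVec_mulVec, conjTranspose_fockMapOp_mul_self f hf,
    one_mulVec]

/-! ### Step 1: directional kinetic weights and `Σ_σ Re⟨ψ, T_σ ψ⟩ = 2 (K_x + K_y)` -/

variable {L : ℕ} [NeZero L]

/-- The `e_{i+1}`-kinetic weight `K_i(ψ) = Σ_{x,σ} Re⟨ψ, c†_{x+e_i,σ} c_{x,σ} ψ⟩` (`i : Fin 2`;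
`kinWeightX = kinWeightDir 0` definitionally). -/
def kinWeightDir (i : Fin 2) (ψ : Fock (Orb (FermionTorus 2 L))) : ℝ :=
  ∑ x : Site 2 L, ∑ σ : Fin 2,
    (star ψ ⬝ᵥ ((creation (orb (FermionTorus.ofTorusSite (x + Pi.single i 1)) σ) *
      annihilation (orb (FermionTorus.ofTorusSite x) σ)) *ᵥ ψ)).re

/-- `kinWeightX ψ = kinWeightDir 0 ψ`. -/
theorem kinWeightX_eq_kinWeightDir (ψ : Fock (Orb (FermionTorus 2 L))) :
    kinWeightX ψ = kinWeightDir 0 ψ := rfl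

/-- The torus hopping operator of one spin as a sum over positively oriented bonds, both orders:
`T_σ = Σ_{x,i} (c†_{x+e_i,σ} c_{x,σ} + c†_{x,σ} c_{x+e_i,σ})` (`L ≥ 3`). -/
theorem hopOp_fermionTorus_two_eq (hL : 3 ≤ L) (σ : Fin 2) :
    hopOp (fermionTorusGraph 2 L) σ =
      ∑ x : Site 2 L, ∑ i : Fin 2,
        (creation (orb (FermionTorus.ofTorusSite (x + Pi.single i 1)) σ) *
            annihilation (orb (FermionTorus.ofTorusSite x) σ) +
          creation (orb (FermionTorus.ofTorusSite x) σ) *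
            annihilation (orb (FermionTorus.ofTorusSite (x + Pi.single i 1)) σ)) := by
  have h1 : hopOp (fermionTorusGraph 2 L) σ = ∑ x : Site 2 L, ∑ y : Site 2 L,
      if (torusGraph 2 L).Adj x y then
        (creation (orb (FermionTorus.ofTorusSite x) σ) *
            annihilation (orb (FermionTorus.ofTorusSite y) σ) :
          Matrix (Finset (Orb (FermionTorus 2 L))) (Finset (Orb (FermionTorus 2 L))) ℂ)
      else 0 := by
    unfold hopOp
    refine Fintype.sum_equiv FermionTorus.equivTorusSite _ _ fun u => ?_
    refine Fintype.sum_equiv FermionTorus.equivTorusSite _ _ fun v => ?_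
    simp only [FermionTorus.equivTorusSite, Equiv.coe_fn_mk, fermionTorusGraph_adj,
      FermionTorus.ofTorusSite_toTorusSite]
  rw [h1, sum_sum_ite_torusGraph_two_adj hL]

/-- `Re⟨ψ, T_σ ψ⟩ = 2 Σ_{x,i} Re⟨ψ, c†_{x+e_i,σ} c_{x,σ} ψ⟩`. -/
theorem re_hopOp_eq_two_mul_sum (hL : 3 ≤ L) (σ : Fin 2) (ψ : Fock (Orb (FermionTorus 2 L))) :
    (star ψ ⬝ᵥ (hopOp (fermionTorusGraph 2 L) σ *ᵥ ψ)).re =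
      2 * ∑ x : Site 2 L, ∑ i : Fin 2,
        (star ψ ⬝ᵥ ((creation (orb (FermionTorus.ofTorusSite (x + Pi.single i 1)) σ) *
          annihilation (orb (FermionTorus.ofTorusSite x) σ)) *ᵥ ψ)).re := by
  rw [hopOp_fermionTorus_two_eq hL σ]
  simp only [Matrix.sum_mulVec, dotProduct_sum, Complex.re_sum, Matrix.add_mulVec, dotProduct_add,
    Complex.add_re, Finset.mul_sum]
  refine Finset.sum_congr rfl fun x _ => Finset.sum_congr rfl fun i _ => ?_
  rw [star_dotProduct_creation_mul_annihilation_mulVec_swap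
      (orb (FermionTorus.ofTorusSite (x + Pi.single i 1)) σ) (orb (FermionTorus.ofTorusSite x) σ) ψ,
    Complex.conj_re]
  ring

/-- `Σ_σ Re⟨ψ, T_σ ψ⟩ = 2 (K_x(ψ) + K_y(ψ))`. -/
theorem sum_re_hopOp_eq (hL : 3 ≤ L) (ψ : Fock (Orb (FermionTorus 2 L))) :
    ∑ σ : Fin 2, (star ψ ⬝ᵥ (hopOp (fermionTorusGraph 2 L) σ *ᵥ ψ)).re =
      2 * (kinWeightDir 0 ψ + kinWeightDir 1 ψ) := by
  simp only [re_hopOp_eq_two_mul_sum hL, kinWeightDir]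
  rw [← Finset.mul_sum, Finset.sum_comm]
  refine congrArg (fun t : ℝ => 2 * t) ?_
  simp only [Fin.sum_univ_two, Finset.sum_add_distrib]

omit [NeZero L] in
/-- On the `N`-particle sector, `Σ_σ Re⟨ψ, N_σ ψ⟩ = N ‖ψ‖² = N` for a unit vector. -/
theorem sum_re_numberOp_eq {N : ℕ} {ψ : Fock (Orb (FermionTorus 2 L))} (hN : IsNParticle N ψ)
    (h1 : star ψ ⬝ᵥ ψ = 1) :
    ∑ σ : Fin 2, (star ψ ⬝ᵥ ((∑ x : FermionTorus 2 L, numberOp x σ) *ᵥ ψ)).re = N := by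
  have htot : ∑ σ : Fin 2, ∑ x : FermionTorus 2 L, numberOp x σ =
      (totalNumber :
        Matrix (Finset (Orb (FermionTorus 2 L))) (Finset (Orb (FermionTorus 2 L))) ℂ) := by
    rw [Finset.sum_comm]; rfl
  rw [← Complex.re_sum, ← dotProduct_sum, ← Matrix.sum_mulVec, htot,
    LangerMattis.totalNumber_mulVec_of_isNParticle hN, dotProduct_smul, h1, smul_eq_mul, mul_one,
    Complex.natCast_re]

/-! ### Step 2: the summed bathtub bound `K_x + K_y ≤ ν N + 2 S(ν)` -/

/-- `max (2a - 2ν) 0 = 2 max (a - ν) 0`. -/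
private theorem max_two_mul_sub (a ν : ℝ) : max (2 * a - 2 * ν) 0 = 2 * max (a - ν) 0 := by
  rcases le_or_gt ν a with h | h
  · rw [max_eq_left (sub_nonneg.2 h), max_eq_left (by linarith)]; ring
  · rw [max_eq_right (sub_nonpos.2 h.le), max_eq_right (by linarith)]; ring

omit [NeZero L] in
/-- `‖ψ‖² = 1` in the `normSq` normalisation of the bathtub lemma. -/
private theorem normSq_eq_one_of_unit {ψ : Fock (Orb (FermionTorus 2 L))} (h1 : star ψ ⬝ᵥ ψ = 1) :
    normSq ψ = 1 := by
  have h := star_dotProduct_self_eq_normSq ψ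
  rw [h1] at h
  exact_mod_cast h.symm

/-- **Summed bathtub bound.** For every unit `N`-particle vector `φ` on the `L × L` torus (`L ≥ 3`)
and every `ν`: `K_x(φ) + K_y(φ) ≤ ν N + 2 Σ_k (cos(2πk₁/L) + cos(2πk₂/L) - ν)⁺`. -/
theorem kinWeightDir_add_le (hL : 3 ≤ L) {N : ℕ} {φ : Fock (Orb (FermionTorus 2 L))}
    (hN : IsNParticle N φ) (h1 : star φ ⬝ᵥ φ = 1) (ν : ℝ) :
    kinWeightDir 0 φ + kinWeightDir 1 φ ≤
      ν * N + 2 * ∑ k : TorusSite 2 L,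
        max (Real.cos (latticeMomentum L k 0) + Real.cos (latticeMomentum L k 1) - ν) 0 := by
  set S : ℝ := ∑ k : TorusSite 2 L,
    max (Real.cos (latticeMomentum L k 0) + Real.cos (latticeMomentum L k 1) - ν) 0 with hS_def
  have hn : normSq φ = 1 := normSq_eq_one_of_unit h1
  have hσ : ∀ σ : Fin 2, (star φ ⬝ᵥ (hopOp (fermionTorusGraph 2 L) σ *ᵥ φ)).re ≤
      (2 * ν) * (star φ ⬝ᵥ ((∑ x : FermionTorus 2 L, numberOp x σ) *ᵥ φ)).re + 2 * S := by
    intro σ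
    have h := re_hopOp_le_oneBodyDual hL σ (2 * ν) φ
    have hS : ∑ k : TorusSite 2 L, max (2 * ∑ i, Real.cos (latticeMomentum L k i) - 2 * ν) 0 =
        2 * S := by
      rw [hS_def, Finset.mul_sum]
      refine Finset.sum_congr rfl fun k _ => ?_
      rw [Fin.sum_univ_two]
      exact max_two_mul_sub _ _
    rw [hS, hn, mul_one] at h
    exact h
  have hsum := Finset.sum_le_sum fun σ (_ : σ ∈ (Finset.univ : Finset (Fin 2))) => hσ σ
  rw [sum_re_hopOp_eq hL φ, Finset.sum_add_distrib, ← Finset.mul_sum, sum_re_numberOp_eq hN h1]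
    at hsum
  simp only [Finset.sum_const, Finset.card_univ, Fintype.card_fin, nsmul_eq_mul, Nat.cast_ofNat]
    at hsum
  linarith

/-! ### Step 3: the rotation `Γ(r)` exchanges `K_x` and `K_y` -/

omit [NeZero L] in
/-- `d4Site (r 1) = rotSite`. -/
private theorem d4Site_r_one_eq (x : TorusSite 2 L) :
    d4Site (DihedralGroup.r 1 : DihedralGroup 4) x = rotSite x := by
  simp only [d4Site]
  rw [show (1 : ZMod 4).val = 1 by decide, Function.iterate_one]

/-- `d4Orb (r 1)` on an orbital over a torus site: `(x, σ) ↦ (rot x, σ)`. -/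
private theorem d4Orb_r_one_orb (z : TorusSite 2 L) (σ : Fin 2) :
    orb (FermionTorus.ofTorusSite (rotSite z)) σ =
      d4Orb (DihedralGroup.r 1 : DihedralGroup 4) (orb (FermionTorus.ofTorusSite z) σ) := by
  rw [← d4Site_r_one_eq]
  simp [d4Orb, orb]

/-- **`K_y(Γ(r)ψ) = K_x(ψ)`** for the second-quantised rotation `Γ(r) = fockMapOp (d4Orb (r 1))`. -/
theorem kinWeightDir_one_rot (ψ : Fock (Orb (FermionTorus 2 L))) :
    kinWeightDir 1 (fockMapOp (d4Orb (DihedralGroup.r 1 : DihedralGroup 4)) *ᵥ ψ) =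
      kinWeightDir 0 ψ := by
  unfold kinWeightDir
  rw [← Equiv.sum_comp (d4SiteEquiv (L := L) (DihedralGroup.r 1 : DihedralGroup 4))]
  refine Finset.sum_congr rfl fun y _ => Finset.sum_congr rfl fun σ _ => ?_
  rw [d4SiteEquiv_apply, d4Site_r_one_eq, ← rotSite_add_single_zero, d4Orb_r_one_orb,
    d4Orb_r_one_orb, star_fockMapOp_mulVec_dotProduct_hop _ (d4Orb_bijective _)]

/-! ### Step 4: the theorems -/

/-- **Proof of `GroundStateKinWeightCeiling`** (bounds.tex Cor. 2.2(iii) at `t' = 0`). -/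
theorem groundStateKinWeightCeiling_holds : GroundStateKinWeightCeiling := by
  intro L _ hL U δ hδ
  obtain ⟨ψ, h1, hgs⟩ := NoGo.exists_unit_groundStateInSector_hubbardTorus L 1 U
    (NoGo.floor_pairNumber_le δ hδ L)
  set n : ℕ := ⌊(1 - δ) * (L : ℝ) ^ 2 / 2⌋₊ with hn_def
  set φ : Fock (Orb (FermionTorus 2 L)) :=
    fockMapOp (d4Orb (DihedralGroup.r 1 : DihedralGroup 4)) *ᵥ ψ with hφ_def
  have hφgs : IsGroundStateInSector (hubbardTorus 2 L 1 U) (2 * n) 0 φ :=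
    hgs.fockMapOp_d4Orb_mulVec _
  have hφ1 : star φ ⬝ᵥ φ = 1 := by
    rw [hφ_def, star_fockMapOp_mulVec_dotProduct_self _ (d4Orb_bijective _).injective, h1]
  have hNφ : IsNParticle (2 * n) φ := ((mem_szSector_iff _ _ _).1 hφgs.1).1
  have hKy : kinWeightDir 1 φ = kinWeightX ψ := kinWeightDir_one_rot ψ
  have hb : ∀ ν : ℝ, kinWeightX φ + kinWeightX ψ ≤
      ν * ((2 * n : ℕ) : ℝ) + 2 * ∑ k : TorusSite 2 L,
        max (Real.cos (latticeMomentum L k 0) + Real.cos (latticeMomentum L k 1) - ν) 0 := by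
    intro ν
    have h := kinWeightDir_add_le hL hNφ hφ1 ν
    rwa [hKy, ← kinWeightX_eq_kinWeightDir] at h
  by_cases hcmp : kinWeightX ψ ≤ kinWeightX φ
  · refine ⟨ψ, hgs, h1, fun ν => ?_⟩
    have h := hb ν
    linarith
  · refine ⟨φ, hφgs, hφ1, fun ν => ?_⟩
    have h := hb ν
    push Not at hcmp
    linarith

/-- **Proof of `HalfBathtubStiffnessBound`** (bounds.tex Cor. 2.2(iii) + Thm 1(c);
Hazra–Verma–Randeria eq. (3) at `T = 0`, now unconditional in the tree): for `L ≥ 3`, `δ ≥ -1`,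
every flux stiffness `ρ_s` of the `(N_L, 0)` sector obeys
`ρ_s L² ≤ ν N_L/2 + Σ_k (cos(2πk₁/L) + cos(2πk₂/L) - ν)⁺` for all `ν`. -/
theorem halfBathtubStiffnessBound_holds : HalfBathtubStiffnessBound :=
  halfBathtubStiffnessBound_of_ceiling groundStateKinWeightCeiling_holds

end Summit.HubbardSuperconductivity.HubbardLadder.Bounds

end
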